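import Summits.HubbardSuperconductivity.HubbardLadder.HubbardTwoPoleClosedForm
import Literature.MathematicalPhysics.QuantumLattice.HeisenbergOrderNeelProofs
import HarnessLib

/-!
# The two-pole (`2 × 2`) semidefinite certificate, IV: the closed form dominates Kennedy–Lieb

HONEST FRAMING (page 1): ladder R1–R4 with certified numbers; no claim on H/H₀; first certified
bounds; not a superconductivity verdict. A SOUNDNESS EDGE of the pub-hubbard cell (seat `pseudo` g64,
`PSEUDO.md` §110 / `TO-ENG.md` §C 130; staged, NOT filed — the FILER decision is the desk's): the
memo prediction `TWOPOLE-NU.md` §3 (P5) as a kernel theorem. On the EVEN torus `(ℤ/2lℤ)^d` the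
closed-form two-pole bound (part III, `hubbardTorus_groundEnergyAt_ge_twoPole_closedForm`) taken at the
Langer–Mattis multipliers `μ_σ = -U/4`, `λ_σ = U/2` is at least the tree's Langer–Mattis–Kennedy–Lieb
bound `hubbardTorus_groundEnergyAt_ge` (`(U/2)N - (U/4)L^d - Σ_k √(ε_k² + U²/16)`) at `N = 2n`, for
every real `t, U` and every `n ≤ (2l)^d`:

`KL_L(U, 2n) ≤ Σ_σ (Σ_k certValue (ε_k - U/4) (U/4) 0 (n/L^d) + (U/4) n)`,

because per momentum `2 · certValue = -ε̃_k - U/4 + ρU/2 - √(ε̃_k² + (U/2)(1-2ρ)ε̃_k + U²/16)`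
(`ε̃_k = siteBand t k`, the pencil determinant is `-(U/4)² ρ(1-ρ) ≤ 0`, so the value is the lower
root), `Σ_k ε̃_k = 0` and `√g(ε̃) + √g(-ε̃) ≤ 2√(ε̃² + U²/16)` (concavity) under the pairing
`k ↦ k - (π,…,π)` of the even torus (`cos_latticeMomentum_sub_neelIndex`). Equality holds at half
filling (`ρ = ½`); away from it (`U ≠ 0`) the pairing inequality is strict wherever `ε̃_k ≠ 0`, and the
optimum over `(μ, λ)` (not taken in Lean) is better still.
[cite: LangerMattis1971, eqs. (3)–(5)][cite: KennedyLieb1986, Theorem 2.1][folklore]. All statements are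
PROVED (no placeholders, no named facts); no new axioms, no instances, no notation.
-/

noncomputable section

namespace Summit.HubbardSuperconductivity.HubbardLadder

open Matrix Finset Literature.MathematicalPhysics.QuantumLattice
  Literature.MathematicalPhysics.QuantumLattice.LangerMattis
  Literature.MathematicalPhysics.QuantumLattice.RayleighBound
  Literature.Probability.LatticeModels TwoPoleCertificate
open scoped ComplexOrder ComplexConjugate

namespace TwoPoleCertificate

/-- If the pencil determinant is `≤ 0` the two roots straddle `0` and the certificate value is the
lower root: `certValue = e₋`. [folklore] -/
theorem certValue_eq_rootLo_of_pencilDet_nonpos (a b d : ℝ) {ρ : ℝ} (h0 : 0 ≤ ρ) (h1 : ρ ≤ 1)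
    (hΔ : pencilDet a b d ρ ≤ 0) : certValue a b d ρ = rootLo a b d ρ := by
  have hprod := rootHi_mul_rootLo a b d h0 h1
  have hle := rootLo_le_rootHi a b d ρ
  have hlo : rootLo a b d ρ ≤ 0 := by
    by_contra h
    have h' := not_le.mp h
    have : 0 < rootHi a b d ρ * rootLo a b d ρ := mul_pos (lt_of_lt_of_le h' hle) h'
    linarith
  have hhi : 0 ≤ rootHi a b d ρ := by
    by_contra h
    have h' := not_le.mp h
    have : 0 < rootHi a b d ρ * rootLo a b d ρ := mul_pos_of_neg_of_neg h' (lt_of_le_of_lt hle h')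
    linarith
  rw [certValue, min_eq_left hhi, min_eq_right hlo, zero_add]

/-- **The certificate value at the Langer–Mattis multipliers** `μ = -U/4`, `λ = U/2`
(`a = -s - U/4`, `b = U/4`, `d = 0`; `0 ≤ ρ ≤ 1`):
`2 · certValue = (-s - U/4 + ρU/2) - √(s² + (U/2)(1-2ρ)s + (U/4)²)`. [folklore] -/
theorem two_mul_certValue_langerMattis (s U : ℝ) {ρ : ℝ} (h0 : 0 ≤ ρ) (h1 : ρ ≤ 1) :
    2 * certValue (-s + -(U / 4)) (U / 2 / 2) (U / 2 - U / 2) ρ =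
      (-s - U / 4 + ρ * U / 2) - Real.sqrt (s ^ 2 + U / 2 * (1 - 2 * ρ) * s + (U / 4) ^ 2) := by
  have hm : 0 ≤ ρ * (1 - ρ) := mul_nonneg h0 (sub_nonneg.mpr h1)
  have hΔ : pencilDet (-s + -(U / 4)) (U / 2 / 2) (U / 2 - U / 2) ρ ≤ 0 := by
    simp only [pencilDet]
    nlinarith [mul_nonneg hm (sq_nonneg (U / 2 / 2))]
  rw [certValue_eq_rootLo_of_pencilDet_nonpos _ _ _ h0 h1 hΔ, rootLo]
  have hτ : pencilTrace (-s + -(U / 4)) (U / 2 / 2) (U / 2 - U / 2) ρ = -s - U / 4 + ρ * U / 2 := by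
    simp only [pencilTrace]
    ring
  have hD : pencilDisc (-s + -(U / 4)) (U / 2 / 2) (U / 2 - U / 2) ρ =
      s ^ 2 + U / 2 * (1 - 2 * ρ) * s + (U / 4) ^ 2 := by
    simp only [pencilDisc, pencilTrace, pencilDet]
    ring
  rw [hτ, hD]
  ring

/-- Concavity of the square root: `√x + √y ≤ 2 √((x + y)/2)` (`x, y ≥ 0`). [folklore] -/
theorem sqrt_add_sqrt_le (x y : ℝ) (hx : 0 ≤ x) (hy : 0 ≤ y) :
    Real.sqrt x + Real.sqrt y ≤ 2 * Real.sqrt ((x + y) / 2) := by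
  have hp := Real.sqrt_nonneg x
  have hq := Real.sqrt_nonneg y
  have hr := Real.sqrt_nonneg ((x + y) / 2)
  have hp2 := Real.sq_sqrt hx
  have hq2 := Real.sq_sqrt hy
  have hr2 : Real.sqrt ((x + y) / 2) ^ 2 = (x + y) / 2 := Real.sq_sqrt (by linarith)
  have h4 : (Real.sqrt x + Real.sqrt y) ^ 2 ≤ (2 * Real.sqrt ((x + y) / 2)) ^ 2 := by
    nlinarith [sq_nonneg (Real.sqrt x - Real.sqrt y)]
  calc Real.sqrt x + Real.sqrt y = Real.sqrt ((Real.sqrt x + Real.sqrt y) ^ 2) :=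
        (Real.sqrt_sq (by positivity)).symm
    _ ≤ Real.sqrt ((2 * Real.sqrt ((x + y) / 2)) ^ 2) := Real.sqrt_le_sqrt h4
    _ = 2 * Real.sqrt ((x + y) / 2) := Real.sqrt_sq (by positivity)

/-- The Langer–Mattis radicand is a sum of squares:
`s² + (U/2)(1-2ρ)s + (U/4)² = (-s - U/4 + ρU/2)² + (U²/4)ρ(1-ρ) ≥ 0` (`0 ≤ ρ ≤ 1`). [folklore] -/
theorem lmRadicand_nonneg (s U : ℝ) {ρ : ℝ} (h0 : 0 ≤ ρ) (h1 : ρ ≤ 1) :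
    0 ≤ s ^ 2 + U / 2 * (1 - 2 * ρ) * s + (U / 4) ^ 2 := by
  have hm : 0 ≤ ρ * (1 - ρ) := mul_nonneg h0 (sub_nonneg.mpr h1)
  nlinarith [sq_nonneg (-s - U / 4 + ρ * U / 2), mul_nonneg hm (sq_nonneg U)]

/-- **The pairing inequality behind (P5)**: `√g(s) + √g(-s) ≤ 2 √(s² + (U/4)²)` for the
Langer–Mattis radicand `g(s) = s² + (U/2)(1-2ρ)s + (U/4)²`, `0 ≤ ρ ≤ 1` (concavity of `√`;
`(g(s) + g(-s))/2 = s² + (U/4)²`). [folklore] -/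
theorem sqrt_lmRadicand_add_le (s U : ℝ) {ρ : ℝ} (h0 : 0 ≤ ρ) (h1 : ρ ≤ 1) :
    Real.sqrt (s ^ 2 + U / 2 * (1 - 2 * ρ) * s + (U / 4) ^ 2) +
        Real.sqrt ((-s) ^ 2 + U / 2 * (1 - 2 * ρ) * (-s) + (U / 4) ^ 2) ≤
      2 * Real.sqrt (s ^ 2 + (U / 4) ^ 2) := by
  have h := sqrt_add_sqrt_le _ _ (lmRadicand_nonneg s U h0 h1) (lmRadicand_nonneg (-s) U h0 h1)
  have hxy : (s ^ 2 + U / 2 * (1 - 2 * ρ) * s + (U / 4) ^ 2 +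
      ((-s) ^ 2 + U / 2 * (1 - 2 * ρ) * (-s) + (U / 4) ^ 2)) / 2 = s ^ 2 + (U / 4) ^ 2 := by ring
  rwa [hxy] at h

/-- **The sum inequality behind (P5)** for any finite additive group `ι`, shift `Q` and
`Q`-antiperiodic `s` (`s(z - Q) = -s(z)`):
`Σ_z (s_z + √g(s_z)) ≤ Σ_z √(s_z² + (U/4)²)`. [folklore] -/
theorem sum_add_sqrt_lmRadicand_le {ι : Type*} [Fintype ι] [AddGroup ι] (Q : ι) (s : ι → ℝ)
    (hs : ∀ z, s (z - Q) = -s z) (U : ℝ) {ρ : ℝ} (h0 : 0 ≤ ρ) (h1 : ρ ≤ 1) :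
    ∑ z, (s z + Real.sqrt (s z ^ 2 + U / 2 * (1 - 2 * ρ) * s z + (U / 4) ^ 2)) ≤
      ∑ z, Real.sqrt (s z ^ 2 + (U / 4) ^ 2) := by
  have hshift : ∑ z, (s (z - Q) + Real.sqrt (s (z - Q) ^ 2 + U / 2 * (1 - 2 * ρ) * s (z - Q) + (U / 4) ^ 2)) =
      ∑ z, (s z + Real.sqrt (s z ^ 2 + U / 2 * (1 - 2 * ρ) * s z + (U / 4) ^ 2)) :=
    Fintype.sum_equiv (Equiv.subRight Q) _ _ fun _ => rfl
  have h2 : 2 * ∑ z, (s z + Real.sqrt (s z ^ 2 + U / 2 * (1 - 2 * ρ) * s z + (U / 4) ^ 2)) =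
      ∑ z, ((s z + Real.sqrt (s z ^ 2 + U / 2 * (1 - 2 * ρ) * s z + (U / 4) ^ 2)) +
        (s (z - Q) + Real.sqrt (s (z - Q) ^ 2 + U / 2 * (1 - 2 * ρ) * s (z - Q) + (U / 4) ^ 2))) := by
    conv_rhs => rw [Finset.sum_add_distrib, hshift]
    ring
  have h3 : ∀ z, (s z + Real.sqrt (s z ^ 2 + U / 2 * (1 - 2 * ρ) * s z + (U / 4) ^ 2)) +
        (s (z - Q) + Real.sqrt (s (z - Q) ^ 2 + U / 2 * (1 - 2 * ρ) * s (z - Q) + (U / 4) ^ 2)) ≤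
      2 * Real.sqrt (s z ^ 2 + (U / 4) ^ 2) := fun z => by
    rw [hs z]
    have := sqrt_lmRadicand_add_le (s z) U h0 h1
    linarith
  have h4 : ∑ z, ((s z + Real.sqrt (s z ^ 2 + U / 2 * (1 - 2 * ρ) * s z + (U / 4) ^ 2)) +
        (s (z - Q) + Real.sqrt (s (z - Q) ^ 2 + U / 2 * (1 - 2 * ρ) * s (z - Q) + (U / 4) ^ 2))) ≤
      ∑ z, 2 * Real.sqrt (s z ^ 2 + (U / 4) ^ 2) :=
    Finset.sum_le_sum fun z _ => h3 z
  rw [← h2, ← Finset.mul_sum] at h4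
  linarith

end TwoPoleCertificate

variable {d : ℕ}

/-- **On the even torus the hopping band is odd under the shift by `Q = (π, …, π)`**:
`ε̃_{z - Q} = -ε̃_z`. [cite: KLS1988JSP, p. 1022][folklore] -/
theorem torusBand_sub_neelIndex (l : ℕ) [NeZero (2 * l)] (t : ℝ) (z : TorusSite d (2 * l)) :
    t * (2 * ∑ i, Real.cos (latticeMomentum (2 * l) (z - neelIndex (2 * l)) i)) =
      -(t * (2 * ∑ i, Real.cos (latticeMomentum (2 * l) z i))) := by
  simp only [cos_latticeMomentum_sub_neelIndex, Finset.sum_neg_distrib]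
  ring

/-- **(P5) The two-pole closed form at the Langer–Mattis multipliers dominates Kennedy–Lieb** on the
even torus `(ℤ/2lℤ)^d`: for all real `t, U` and `n ≤ (2l)^d`,
`(U/2)(2n) - (U/4)(2l)^d - Σ_k √(ε_k² + U²/16) ≤ Σ_σ (Σ_k certValue (-ε̃_k - U/4) (U/4) 0 (n/(2l)^d) + (U/4) n)`
— the left side is literally the bound of `hubbardTorus_groundEnergyAt_ge` at `N = 2n`, the right side
literally the bound of `hubbardTorus_groundEnergyAt_ge_twoPole_closedForm` at `μ_σ = -U/4`, `λ_σ = U/2`.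
[cite: LangerMattis1971, eqs. (3)–(5)][cite: KennedyLieb1986, Theorem 2.1][folklore] -/
theorem kennedyLieb_le_twoPole_closedForm (l : ℕ) [NeZero (2 * l)] (t U : ℝ) {n : ℕ}
    (hn : n ≤ (2 * l) ^ d) :
    U / 2 * ((2 * n : ℕ) : ℝ) - (U / 4 * ((2 * l : ℕ) : ℝ) ^ d +
        ∑ k : TorusSite d (2 * l),
          Real.sqrt ((t * (2 * ∑ i, Real.cos (latticeMomentum (2 * l) k i))) ^ 2 + (U / 4) ^ 2)) ≤
      ∑ _σ : Fin 2, ((∑ k : FermionTorus d (2 * l),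
          certValue (-(siteBand t k) + -(U / 4)) (U / 2 / 2) (U / 2 - U / 2)
            ((n : ℝ) / ((2 * l : ℕ) : ℝ) ^ d)) - -(U / 4) * n) := by
  have h2l : (0 : ℝ) < ((2 * l : ℕ) : ℝ) := by exact_mod_cast Nat.pos_of_ne_zero (NeZero.ne (2 * l))
  have hL : (0 : ℝ) < ((2 * l : ℕ) : ℝ) ^ d := pow_pos h2l d
  have h0 : (0 : ℝ) ≤ (n : ℝ) / ((2 * l : ℕ) : ℝ) ^ d := div_nonneg (Nat.cast_nonneg n) hL.le
  have h1 : (n : ℝ) / ((2 * l : ℕ) : ℝ) ^ d ≤ 1 := by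
    rw [div_le_one hL]
    exact_mod_cast hn
  have hρL : (n : ℝ) / ((2 * l : ℕ) : ℝ) ^ d * ((2 * l : ℕ) : ℝ) ^ d = n := div_mul_cancel₀ _ hL.ne'
  have hcard : (Fintype.card (TorusSite d (2 * l)) : ℝ) = ((2 * l : ℕ) : ℝ) ^ d := by
    simp only [Fintype.card_pi, ZMod.card, Finset.prod_const, Finset.card_univ, Fintype.card_fin]
    push_cast
    ring
  -- the closed form, summed over momenta, in torus coordinates
  have hsum : 2 * ∑ k : FermionTorus d (2 * l),
      certValue (-(siteBand t k) + -(U / 4)) (U / 2 / 2) (U / 2 - U / 2) ((n : ℝ) / ((2 * l : ℕ) : ℝ) ^ d) =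
      ∑ z : TorusSite d (2 * l),
        ((-(t * (2 * ∑ i, Real.cos (latticeMomentum (2 * l) z i))) - U / 4 +
            (n : ℝ) / ((2 * l : ℕ) : ℝ) ^ d * U / 2) -
          Real.sqrt ((t * (2 * ∑ i, Real.cos (latticeMomentum (2 * l) z i))) ^ 2 +
            U / 2 * (1 - 2 * ((n : ℝ) / ((2 * l : ℕ) : ℝ) ^ d)) *
              (t * (2 * ∑ i, Real.cos (latticeMomentum (2 * l) z i))) + (U / 4) ^ 2)) := by
    rw [Finset.mul_sum, FermionTorus.sum_eq_sum_torusSite]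
    refine Finset.sum_congr rfl fun z _ => ?_
    rw [two_mul_certValue_langerMattis _ _ h0 h1]
    simp only [siteBand, FermionTorus.toTorusSite_ofTorusSite]
  -- the pairing inequality on the even torus
  have hpair := TwoPoleCertificate.sum_add_sqrt_lmRadicand_le (neelIndex (2 * l))
    (fun z : TorusSite d (2 * l) => t * (2 * ∑ i, Real.cos (latticeMomentum (2 * l) z i)))
    (torusBand_sub_neelIndex l t) U h0 h1
  have hsplit : ∑ z : TorusSite d (2 * l),
        ((-(t * (2 * ∑ i, Real.cos (latticeMomentum (2 * l) z i))) - U / 4 +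
            (n : ℝ) / ((2 * l : ℕ) : ℝ) ^ d * U / 2) -
          Real.sqrt ((t * (2 * ∑ i, Real.cos (latticeMomentum (2 * l) z i))) ^ 2 +
            U / 2 * (1 - 2 * ((n : ℝ) / ((2 * l : ℕ) : ℝ) ^ d)) *
              (t * (2 * ∑ i, Real.cos (latticeMomentum (2 * l) z i))) + (U / 4) ^ 2)) =
      -(∑ z : TorusSite d (2 * l),
          (t * (2 * ∑ i, Real.cos (latticeMomentum (2 * l) z i)) +
            Real.sqrt ((t * (2 * ∑ i, Real.cos (latticeMomentum (2 * l) z i))) ^ 2 +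
              U / 2 * (1 - 2 * ((n : ℝ) / ((2 * l : ℕ) : ℝ) ^ d)) *
                (t * (2 * ∑ i, Real.cos (latticeMomentum (2 * l) z i))) + (U / 4) ^ 2))) +
        (Fintype.card (TorusSite d (2 * l)) : ℝ) * (-(U / 4) + (n : ℝ) / ((2 * l : ℕ) : ℝ) ^ d * U / 2) := by
    simp only [Finset.sum_sub_distrib, Finset.sum_add_distrib, Finset.sum_neg_distrib, Finset.sum_const,
      Finset.card_univ, nsmul_eq_mul]
    ring
  have hconst : ((2 * l : ℕ) : ℝ) ^ d * (-(U / 4) + (n : ℝ) / ((2 * l : ℕ) : ℝ) ^ d * U / 2) =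
      -(U / 4) * ((2 * l : ℕ) : ℝ) ^ d + U / 2 * n := by
    have : ((2 * l : ℕ) : ℝ) ^ d * ((n : ℝ) / ((2 * l : ℕ) : ℝ) ^ d) = n := by
      rw [mul_comm]; exact hρL
    calc ((2 * l : ℕ) : ℝ) ^ d * (-(U / 4) + (n : ℝ) / ((2 * l : ℕ) : ℝ) ^ d * U / 2)
        = -(U / 4) * ((2 * l : ℕ) : ℝ) ^ d +
            U / 2 * (((2 * l : ℕ) : ℝ) ^ d * ((n : ℝ) / ((2 * l : ℕ) : ℝ) ^ d)) := by ring
      _ = -(U / 4) * ((2 * l : ℕ) : ℝ) ^ d + U / 2 * n := by rw [this]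
  have hsum' := hsum
  rw [hsplit, hcard, hconst] at hsum'
  have hpair' : ∑ z : TorusSite d (2 * l),
        (t * (2 * ∑ i, Real.cos (latticeMomentum (2 * l) z i)) +
          Real.sqrt ((t * (2 * ∑ i, Real.cos (latticeMomentum (2 * l) z i))) ^ 2 +
            U / 2 * (1 - 2 * ((n : ℝ) / ((2 * l : ℕ) : ℝ) ^ d)) *
              (t * (2 * ∑ i, Real.cos (latticeMomentum (2 * l) z i))) + (U / 4) ^ 2)) ≤
      ∑ z : TorusSite d (2 * l),
        Real.sqrt ((t * (2 * ∑ i, Real.cos (latticeMomentum (2 * l) z i))) ^ 2 + (U / 4) ^ 2) := hpair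
  rw [Fin.sum_univ_two]
  generalize ((2 * l : ℕ) : ℝ) ^ d = N at hsum' hpair' ⊢
  push_cast
  linarith [hsum', hpair']

/-- **Corollary (P5 on the ground-state energy).** On the even torus `(ℤ/2lℤ)^d`, `2l ≥ 3`, any real
`t, U`, `0 < n < (2l)^d`: Kennedy–Lieb's bound `≤` the two-pole closed form at `μ_σ = -U/4`,
`λ_σ = U/2` `≤ E_L(2n)`. [cite: LangerMattis1971, eqs. (3)–(5)][cite: KennedyLieb1986, Theorem 2.1]
[folklore] -/
theorem kennedyLieb_le_twoPole_closedForm_le_groundEnergyAt (l : ℕ) [NeZero (2 * l)] (hL : 3 ≤ 2 * l)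
    (t U : ℝ) {n : ℕ} (hn0 : 0 < n) (hn : n < (2 * l) ^ d) :
    U / 2 * ((2 * n : ℕ) : ℝ) - (U / 4 * ((2 * l : ℕ) : ℝ) ^ d +
        ∑ k : TorusSite d (2 * l),
          Real.sqrt ((t * (2 * ∑ i, Real.cos (latticeMomentum (2 * l) k i))) ^ 2 + (U / 4) ^ 2)) ≤
      ∑ _σ : Fin 2, ((∑ k : FermionTorus d (2 * l),
          certValue (-(siteBand t k) + -(U / 4)) (U / 2 / 2) (U / 2 - U / 2)
            ((n : ℝ) / ((2 * l : ℕ) : ℝ) ^ d)) - -(U / 4) * n) ∧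
    ∑ _σ : Fin 2, ((∑ k : FermionTorus d (2 * l),
          certValue (-(siteBand t k) + -(U / 4)) (U / 2 / 2) (U / 2 - U / 2)
            ((n : ℝ) / ((2 * l : ℕ) : ℝ) ^ d)) - -(U / 4) * n) ≤
      groundEnergyAt (fermionTorusGraph d (2 * l)) t U (2 * n) := by
  exact ⟨kennedyLieb_le_twoPole_closedForm l t U hn.le,
    hubbardTorus_groundEnergyAt_ge_twoPole_closedForm hL t U (fun _ => -(U / 4)) (fun _ => U / 2) hn0 hn⟩

end Summit.HubbardSuperconductivity.HubbardLadder
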